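import Mathlib.Algebra.MonoidAlgebra.Basic
import Mathlib.Algebra.Algebra.Rat
import Mathlib.Data.Complex.Basic
import Mathlib.LinearAlgebra.Matrix.Determinant.Basic
import Mathlib.Logic.Relation
import Mathlib.Tactic.FieldSimp
import Mathlib.Tactic.Ring
import HarnessLib

/-!
# Mutations of Laurent polynomials and mutation-equivalence (Akhtar–Coates–Galkin–Kasprzyk 2012)

Definition request `defn-IsMutationEquivalent` (route MarkovTreeOfMoves of the summit
KontsevichZagierPeriods; informal crux *MutationCompleteness*).

A *mutation* in the sense of Galkin–Usnich (2010, two variables) and Akhtar–Coates–Galkin–Kasprzyk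
(SIGMA 8 (2012) 094 = arXiv:1212.1785, §2) is a birational transformation `φ` of the complex torus
`(ℂˣ)ⁿ` obtained by composing a `GLₙ(ℤ)`-equivalence `x ↦ x^M` (Definition 1), a map of the form
`(x', x₀) ↦ (x', A(x') x₀)` with `A` a Laurent polynomial in the other variables (Example 2, the
*elementary algebraic mutation in adapted coordinates*), and another `GLₙ(ℤ)`-equivalence
(Definition 2, stated for `n = 3`; Remark 2: "One can also define mutations of Laurent polynomials
in `n` variables, using the obvious generalisations"). Two Laurent polynomials `f`, `g` are *related
by the mutation* `φ` if `φ^* f = g` (Definition 2); the pull-back of a Laurent polynomial is a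
Laurent polynomial only under the divisibility condition `A^{-i} ∣ C_i` on the negative
`x₀`-degree parts of `f = Σ C_i x₀^i` (Remark 1). Laurent polynomials are *mutation-equivalent*
("connected by a sequence of mutations", §1 and §5; "mutation-equivalent", §3) if they are joined
by a finite chain of mutations.

## Main definitions

* `LaurentPoly n = AddMonoidAlgebra ℚ (Fin n → ℤ)`: Laurent polynomials in `n` variables over `ℚ`
  (the type used by the route's statements), with `LaurentPoly.torusEval f x =
  f.coeff.sum fun v c => (c : ℂ) * ∏ i, x i ^ v i`, the evaluation at a point `x` of the complex
  torus (verbatim the route's `ev`), and `LaurentPoly.monomialMap A x = fun i => ∏ j, x j ^ A i j`,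
  the monomial map `x ↦ x^A`.
* `IsMonomialTransform A f g`: `A ∈ GLₙ(ℤ)` (`IsUnit A.det`) and `g = f ∘ (x ↦ x^A)` on the torus
  (ACGK Definition 1).
* `IsElementaryMutation i F f g`: `F ≠ 0` does not involve the variable `x_i`, and
  `g(x) = f(x₀, …, x_i F(x), …, x_{n-1})` wherever `F(x) ≠ 0` on the torus (ACGK Example 2 in
  adapted coordinates, the distinguished variable being `x_i`).
* `MutationStep f g`: `f` and `g` are related by a `GLₙ(ℤ)`-equivalence or by an elementary
  mutation; `IsMutationEquivalent f g`: the equivalence relation generated by `MutationStep`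
  (`Relation.EqvGen`).

## Faithfulness and design

* **Pull-back as an identity of functions on the torus.** ACGK define `φ^* f = g` for a birational
  map `φ` of `(ℂˣ)ⁿ`, i.e. an identity of rational functions, equivalently of their values on the
  dense open subset of the torus where `φ` is defined. Both clauses are therefore stated as
  identities of `torusEval` at all points with non-zero coordinates (and `F(x) ≠ 0` for the
  elementary mutation). Since a Laurent polynomial over `ℚ ⊂ ℂ` is determined by its values on
  `(ℂˣ)ⁿ`, this is the printed notion; the requirement that `g` be again a Laurent polynomial
  (Remark 1) is carried by the type of `g`. This is also letter for letter the hypothesis shape of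
  the route's items `MutationIsAMove` (with `i = 0`) and `MonomialMapIsAMove`.
* **Generators.** Definition 2's mutations are the composites `M₁ ∘ μ ∘ M₂`; the equivalence
  relation they generate coincides with the one generated by `GLₙ(ℤ)`-equivalences and elementary
  mutations separately (take `μ` with `F = 1`, resp. `M₁ = M₂ = 1`;
  `isElementaryMutation_one_self`, `isMonomialTransform_one_self`), which is what is recorded. The
  distinguished variable of an elementary mutation may be any `x_i` (a permutation of the variables
  is a `GLₙ(ℤ)`-equivalence), which avoids casts along `Fin (m + 1) = Fin n`. General (non-adapted)
  mutations `mut_w(·, F)` with respect to a primitive weight vector `w` (ACGK §3) are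
  `GLₙ(ℤ)`-conjugates of elementary ones and generate the same relation.
* **`GLₙ(ℤ)` versus `SLₙ(ℤ)`.** Definition 1 is rendered with `GLₙ(ℤ)` (`IsUnit A.det`), as in the
  route's `MonomialMapIsAMove` and in ACGK §3 (polytopes up to `GLₙ(ℤ)`); restricting to
  determinant `1` would a priori give a finer relation.
* **Symmetry.** The inverse of `x_i ↦ x_i F` is `x_i ↦ x_i / F`, not of the same shape unless `F`
  is a monomial; "equivalence" is the equivalence relation *generated*, so `Relation.EqvGen`
  supplies symmetry, as the sources' "mutation-equivalent" does.
* The exponent lattice is `ℤⁿ` itself (the route records why mutation-completeness must be stated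
  with `N_f = ℤⁿ`); sublattice phenomena (`f(x, y)` versus `f(x, y²)`) are not mutations here, as
  in ACGK.
* Not vendored: the combinatorial mutations of polytopes (ACGK §3), period invariance (ACGK
  Lemma 1; it is the content of the route's `MutationIsAMove`), maximally mutable Laurent
  polynomials (Coates–Kasprzyk–Pitton–Tveiten 2021; a separate request `IsRigidMMLP`).

## API (proved)

`torusEval_single/zero/add/one`, `torusEval_mul/pow` (on the torus, through
`AddMonoidAlgebra.lift` and the character `torusChar`), `monomialMap_one`,
`isMonomialTransform_one_self`, `isElementaryMutation_one_self`, the `Equivalence` structure of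
`IsMutationEquivalent` and the embeddings of the generators, and ACGK's Example 1 in two variables
(`acgk_example_isElementaryMutation`: `x₀⁻¹(1 + x₁) + x₀ ↦ x₀⁻¹ + x₀(1 + x₁)` along
`x₀ ↦ x₀ (1 + x₁)`), a non-vacuity witness.

## References

* M. Akhtar, T. Coates, S. Galkin, A. M. Kasprzyk, *Minkowski polynomials and mutations*, SIGMA 8
  (2012) 094 = arXiv:1212.1785, §2: Examples 1–2, Remark 1, Definitions 1–2, Remark 2, Lemma 1
  [AkhtarCoatesGalkinKasprzyk2012].
* S. Galkin, A. Usnich, *Mutations of potentials*, preprint IPMU 10-0100 (2010) (the two-variable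
  origin of the notion; cited through ACGK).
-/

noncomputable section

open Finset Function

namespace Literature.AlgebraicGeometry.Mutations

/-- **Laurent polynomials in `n` variables over `ℚ`**, `ℚ[x₁^{±1}, …, xₙ^{±1}]`, as the group
algebra of `ℤⁿ` (the type `AddMonoidAlgebra ℚ (Fin n → ℤ)` used by route MarkovTreeOfMoves; ACGK
2012, §1: `f ∈ ℂ[x₁^{±1}, …, xₙ^{±1}]`, here with rational coefficients). [cite: AkhtarCoatesGalkinKasprzyk2012, §1] -/
abbrev LaurentPoly (n : ℕ) : Type := AddMonoidAlgebra ℚ (Fin n → ℤ)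

namespace LaurentPoly

variable {n : ℕ}

/-- **Evaluation of a Laurent polynomial at a point of the complex torus** `(ℂˣ)ⁿ`:
`f(x) = Σ_v c_v ∏ᵢ xᵢ^{vᵢ}` (integer powers `zpow`; meaningful for `xᵢ ≠ 0`, junk-free but
uninteresting at points with a zero coordinate, where `0⁻¹ = 0`). Verbatim the evaluation `ev` of
the route's statements. [folklore] -/
def torusEval (f : LaurentPoly n) (x : Fin n → ℂ) : ℂ :=
  f.coeff.sum fun v c => (c : ℂ) * ∏ i, x i ^ v i

/-- **The monomial map `x ↦ x^A`** of the torus attached to an integer matrix `A`: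
`(x^A)ᵢ = ∏ⱼ xⱼ^{A i j}` (ACGK 2012, Definition 1: `(x,y,z) ↦ (xᵃyᵇzᶜ, xᵈyᵉzᶠ, xᵍyʰzⁱ)` for
`M = (a b c; d e f; g h i)`, the rows giving the new coordinates). [cite: AkhtarCoatesGalkinKasprzyk2012, §2 Def. 1] -/
def monomialMap (A : Matrix (Fin n) (Fin n) ℤ) (x : Fin n → ℂ) : Fin n → ℂ :=
  fun i => ∏ j, x j ^ A i j

/-- Evaluation of a monomial `c x^v`. [folklore] -/
@[simp] theorem torusEval_single (v : Fin n → ℤ) (c : ℚ) (x : Fin n → ℂ) :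
    torusEval (AddMonoidAlgebra.single v c) x = (c : ℂ) * ∏ i, x i ^ v i := by
  simp [torusEval, AddMonoidAlgebra.coeff_single, Finsupp.sum_single_index]

/-- Evaluation of `0`. [folklore] -/
@[simp] theorem torusEval_zero (x : Fin n → ℂ) : torusEval (0 : LaurentPoly n) x = 0 := by
  simp [torusEval]

/-- Evaluation is additive. [folklore] -/
theorem torusEval_add (f g : LaurentPoly n) (x : Fin n → ℂ) :
    torusEval (f + g) x = torusEval f x + torusEval g x := by
  simp only [torusEval, AddMonoidAlgebra.coeff_add]
  exact Finsupp.sum_add_index' (fun v => by simp) (fun v c₁ c₂ => by push_cast; ring)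

/-- Evaluation of `1`. [folklore] -/
@[simp] theorem torusEval_one (x : Fin n → ℂ) : torusEval (1 : LaurentPoly n) x = 1 := by
  rw [AddMonoidAlgebra.one_def, torusEval_single]
  simp

/-- **The character `v ↦ x^v` of `ℤⁿ` at a point `x` of the complex torus** (all `xᵢ ≠ 0`), a
monoid homomorphism `Multiplicative ℤⁿ →* ℂ` (`x^{v+w} = x^v x^w` needs `xᵢ ≠ 0`). [folklore] -/
def torusChar (x : Fin n → ℂ) (hx : ∀ i, x i ≠ 0) : Multiplicative (Fin n → ℤ) →* ℂ where
  toFun v := ∏ i, x i ^ (Multiplicative.toAdd v) i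
  map_one' := by simp
  map_mul' v w := by
    rw [← Finset.prod_mul_distrib]
    refine Finset.prod_congr rfl fun i _ => ?_
    rw [toAdd_mul, Pi.add_apply, zpow_add₀ (hx i)]

/-- On the torus, evaluation is the algebra homomorphism `AddMonoidAlgebra.lift` of the character
`torusChar x`. [folklore] -/
theorem torusEval_eq_lift (f : LaurentPoly n) {x : Fin n → ℂ} (hx : ∀ i, x i ≠ 0) :
    torusEval f x = AddMonoidAlgebra.lift ℚ ℂ (Fin n → ℤ) (torusChar x hx) f := by
  rw [AddMonoidAlgebra.lift_apply']
  unfold torusEval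
  refine Finsupp.sum_congr fun v _ => ?_
  rw [eq_ratCast]
  rfl

/-- On the torus, evaluation is multiplicative. [folklore] -/
theorem torusEval_mul (f g : LaurentPoly n) {x : Fin n → ℂ} (hx : ∀ i, x i ≠ 0) :
    torusEval (f * g) x = torusEval f x * torusEval g x := by
  simp only [torusEval_eq_lift _ hx, map_mul]

/-- On the torus, evaluation commutes with powers. [folklore] -/
theorem torusEval_pow (f : LaurentPoly n) {x : Fin n → ℂ} (hx : ∀ i, x i ≠ 0) (k : ℕ) :
    torusEval (f ^ k) x = torusEval f x ^ k := by
  simp only [torusEval_eq_lift _ hx, map_pow]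

/-- The identity matrix gives the identity monomial map. [folklore] -/
@[simp] theorem monomialMap_one (x : Fin n → ℂ) :
    monomialMap (1 : Matrix (Fin n) (Fin n) ℤ) x = x := by
  funext i
  simp only [monomialMap, Matrix.one_apply]
  rw [Finset.prod_eq_single i (fun j _ hj => by simp [Ne.symm hj]) (by simp)]
  simp

end LaurentPoly

open LaurentPoly

variable {n : ℕ}

/-- **`GLₙ(ℤ)`-equivalence of Laurent polynomials** (Akhtar–Coates–Galkin–Kasprzyk, SIGMA 8
(2012) 094 = arXiv:1212.1785, §2, Definition 1: "A `GL₃(ℤ)`-equivalence is an isomorphism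
`(ℂˣ)³ → (ℂˣ)³` of the form `(x,y,z) ↦ (xᵃyᵇzᶜ, xᵈyᵉzᶠ, xᵍyʰzⁱ)` where `M ∈ GL₃(ℤ)`"; Remark 2
for `n` variables; Definition 2: `f` and `g` are related by `φ` if `φ^* f = g`). `f` and `g` are
related by the monomial change of variables `x ↦ x^A`, `A ∈ GLₙ(ℤ)` (`IsUnit A.det`, i.e.
`det A = ±1`): `g(x) = f(x^A)` at every point of the complex torus (all `xᵢ ≠ 0`). The identity
on the torus is the printed identity of (rational) functions `g = (x ↦ x^A)^* f` (module
docstring); it is the hypothesis shape of the route's `MonomialMapIsAMove`. [cite: AkhtarCoatesGalkinKasprzyk2012, §2 Def. 1–2 and Rem. 2] -/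
def IsMonomialTransform (A : Matrix (Fin n) (Fin n) ℤ) (f g : LaurentPoly n) : Prop :=
  IsUnit A.det ∧ ∀ x : Fin n → ℂ, (∀ i, x i ≠ 0) → torusEval g x = torusEval f (monomialMap A x)

/-- **Elementary algebraic mutation in adapted coordinates** (Akhtar–Coates–Galkin–Kasprzyk, SIGMA
8 (2012) 094 = arXiv:1212.1785, §2, Example 2 with Remarks 1–2: for `f = Σ_{i=k}^{l} C_i(x,y) zⁱ`
and a Laurent polynomial `A(x,y)` with `A^{-i} ∣ C_i` for `k ≤ i ≤ −1`, "the pullback of `f` along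
the birational transformation `(x,y,z) ↦ (x, y, A(x,y) z)` is `g = Σ A(x,y)ⁱ C_i(x,y) zⁱ`. We say
that the Laurent polynomials `f` and `g` are related by the mutation"; Remark 1: without the
divisibility condition the pull-back is not a Laurent polynomial). With the distinguished variable
`x_i` in the role of `z`: `F ≠ 0` is a Laurent polynomial not involving `x_i` (every exponent `v`
in its support has `vᵢ = 0`), and `g(x) = f(x₀, …, x_{i−1}, xᵢ F(x), x_{i+1}, …)` at every point
of the torus where `F(x) ≠ 0`. Since `g` is a Laurent polynomial by type, the divisibility
condition of Remark 1 is implied; the identity on the dense open set `{F ≠ 0}` of the torus is the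
printed identity `g = φ^* f` of rational functions (module docstring). With `i = 0` this is
letter for letter the hypothesis of the route's `MutationIsAMove`. [cite: AkhtarCoatesGalkinKasprzyk2012, §2 Example 2, Rem. 1–2] -/
def IsElementaryMutation (i : Fin n) (F f g : LaurentPoly n) : Prop :=
  F ≠ 0 ∧ (∀ v ∈ F.coeff.support, v i = 0) ∧
    ∀ x : Fin n → ℂ, (∀ j, x j ≠ 0) → torusEval F x ≠ 0 →
      torusEval g x = torusEval f (Function.update x i (x i * torusEval F x))

/-- **One mutation step**: `f` and `g` are related either by a `GLₙ(ℤ)`-equivalence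
(`IsMonomialTransform`) or by an elementary algebraic mutation in adapted coordinates
(`IsElementaryMutation`) — the two constituents of a mutation in the sense of ACGK 2012,
Definition 2 (a composite `GLₙ(ℤ)`-equivalence ∘ elementary mutation ∘ `GLₙ(ℤ)`-equivalence);
the generated equivalence relations agree (module docstring, "Generators"). [cite: AkhtarCoatesGalkinKasprzyk2012, §2 Def. 2] -/
def MutationStep (f g : LaurentPoly n) : Prop :=
  (∃ A : Matrix (Fin n) (Fin n) ℤ, IsMonomialTransform A f g) ∨
    ∃ (i : Fin n) (F : LaurentPoly n), IsElementaryMutation i F f g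

/-- **Mutation-equivalence of Laurent polynomials** over `ℚ` in `n` variables (exponent lattice
`ℤⁿ`): the equivalence relation generated by the mutation steps — `GLₙ(ℤ)`-equivalences
`g(x) = f(x^A)` and elementary algebraic mutations `g(x) = f(…, xᵢ F(x), …)` in adapted coordinates
(Akhtar–Coates–Galkin–Kasprzyk 2012, §2 Definitions 1–2 and Remark 2; "connected by a sequence
of mutations", §§1, 5; "mutation-equivalent", §3; after Galkin–Usnich 2010). Rendered as
`Relation.EqvGen MutationStep`, so that it is reflexive, symmetric (the inverse birational map
`xᵢ ↦ xᵢ / F` is not itself of elementary shape) and transitive by construction. This is the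
notion needed to type the informal crux *MutationCompleteness* of route MarkovTreeOfMoves ("rigid
maximally mutable Laurent polynomials with `N_f = N_g = ℤⁿ` and equal period sequences are
mutation-equivalent"). [cite: AkhtarCoatesGalkinKasprzyk2012, §2 Def. 1–2, Rem. 2; §§1, 3, 5 (mutation-equivalence)] -/
def IsMutationEquivalent (f g : LaurentPoly n) : Prop :=
  Relation.EqvGen MutationStep f g

/-! ### API -/

/-- The identity matrix relates every Laurent polynomial to itself (`x ↦ x^1 = x`). [folklore] -/
theorem isMonomialTransform_one_self (f : LaurentPoly n) : IsMonomialTransform 1 f f :=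
  ⟨by simp, fun x _ => by rw [monomialMap_one]⟩

/-- The trivial elementary mutation `F = 1` (`xᵢ ↦ xᵢ`) relates every Laurent polynomial to
itself; in particular a pure `GLₙ(ℤ)`-equivalence is a mutation in the sense of ACGK's
Definition 2 (take the middle factor trivial). [cite: AkhtarCoatesGalkinKasprzyk2012, §2 Def. 2] -/
theorem isElementaryMutation_one_self (i : Fin n) (f : LaurentPoly n) :
    IsElementaryMutation i 1 f f := by
  refine ⟨one_ne_zero, fun v hv => ?_, fun x _ _ => by simp⟩
  rw [AddMonoidAlgebra.one_def, AddMonoidAlgebra.coeff_single] at hv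
  have := Finsupp.support_single_subset hv
  rw [Finset.mem_singleton] at this
  simp [this]

/-- Mutation-equivalence is reflexive. [folklore] -/
theorem IsMutationEquivalent.refl (f : LaurentPoly n) : IsMutationEquivalent f f :=
  Relation.EqvGen.refl f

/-- Mutation-equivalence is symmetric. [folklore] -/
theorem IsMutationEquivalent.symm {f g : LaurentPoly n} (h : IsMutationEquivalent f g) :
    IsMutationEquivalent g f :=
  Relation.EqvGen.symm _ _ h

/-- Mutation-equivalence is transitive ("connected by a sequence of mutations"). [cite: AkhtarCoatesGalkinKasprzyk2012, §1 and §5] -/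
theorem IsMutationEquivalent.trans {f g h : LaurentPoly n} (h₁ : IsMutationEquivalent f g)
    (h₂ : IsMutationEquivalent g h) : IsMutationEquivalent f h :=
  Relation.EqvGen.trans _ _ _ h₁ h₂

/-- Mutation-equivalence is an equivalence relation. [folklore] -/
theorem isMutationEquivalent_equivalence : Equivalence (IsMutationEquivalent (n := n)) :=
  Relation.EqvGen.is_equivalence _

/-- A mutation step is a mutation-equivalence. [folklore] -/
theorem MutationStep.isMutationEquivalent {f g : LaurentPoly n} (h : MutationStep f g) :
    IsMutationEquivalent f g :=
  Relation.EqvGen.rel _ _ h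

/-- `GLₙ(ℤ)`-equivalent Laurent polynomials are mutation-equivalent. [cite: AkhtarCoatesGalkinKasprzyk2012, §2 Def. 1–2] -/
theorem IsMonomialTransform.isMutationEquivalent {A : Matrix (Fin n) (Fin n) ℤ}
    {f g : LaurentPoly n} (h : IsMonomialTransform A f g) : IsMutationEquivalent f g :=
  MutationStep.isMutationEquivalent (Or.inl ⟨A, h⟩)

/-- Laurent polynomials related by an elementary mutation are mutation-equivalent. [cite: AkhtarCoatesGalkinKasprzyk2012, §2 Def. 2] -/
theorem IsElementaryMutation.isMutationEquivalent {i : Fin n} {F f g : LaurentPoly n}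
    (h : IsElementaryMutation i F f g) : IsMutationEquivalent f g :=
  MutationStep.isMutationEquivalent (Or.inr ⟨i, F, h⟩)

/-! ### ACGK's Example 1 in two variables (non-vacuity) -/

section Example

open AddMonoidAlgebra

/-- The mutation factor `F = 1 + x₁` of the two-variable instance of ACGK's Example 1
(`f = A z⁻¹ + B + C z ↦ g = z⁻¹ + B + AC z` along `z ↦ A z`, with `z = x₀`, `A = 1 + x₁`, `B = 0`,
`C = 1`). [cite: AkhtarCoatesGalkinKasprzyk2012, §2 Example 1] -/
def acgkExampleFactor : LaurentPoly 2 := single ![0, 0] 1 + single ![0, 1] 1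

/-- The source `f = x₀⁻¹ (1 + x₁) + x₀` of the two-variable instance of ACGK's Example 1. [cite: AkhtarCoatesGalkinKasprzyk2012, §2 Example 1] -/
def acgkExampleSource : LaurentPoly 2 := single ![-1, 0] 1 + single ![-1, 1] 1 + single ![1, 0] 1

/-- The target `g = x₀⁻¹ + x₀ (1 + x₁)` of the two-variable instance of ACGK's Example 1. [cite: AkhtarCoatesGalkinKasprzyk2012, §2 Example 1] -/
def acgkExampleTarget : LaurentPoly 2 := single ![-1, 0] 1 + single ![1, 0] 1 + single ![1, 1] 1

/-- The factor `1 + x₁` does not involve `x₀`. [cite: AkhtarCoatesGalkinKasprzyk2012, §2 Example 1] -/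
theorem acgkExampleFactor_support (v : Fin 2 → ℤ) (hv : v ∈ acgkExampleFactor.coeff.support) :
    v 0 = 0 := by
  simp only [acgkExampleFactor, coeff_add, coeff_single] at hv
  have := Finsupp.support_add hv
  simp only [Finset.mem_union] at this
  rcases this with h | h <;>
    · have := Finsupp.support_single_subset h
      rw [Finset.mem_singleton] at this
      simp [this]

/-- **ACGK's Example 1 in two variables**: `x₀⁻¹ (1 + x₁) + x₀` and `x₀⁻¹ + x₀ (1 + x₁)` are
related by the elementary mutation `x₀ ↦ x₀ (1 + x₁)` (the instance `A = 1 + x₁`, `B = 0`, `C = 1`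
of `A z⁻¹ + B + C z ↦ z⁻¹ + B + AC z`); a non-vacuity witness for `IsElementaryMutation`, hence for
`IsMutationEquivalent` (`acgk_example_isMutationEquivalent`). [cite: AkhtarCoatesGalkinKasprzyk2012, §2 Example 1] -/
theorem acgk_example_isElementaryMutation :
    IsElementaryMutation 0 acgkExampleFactor acgkExampleSource acgkExampleTarget := by
  refine ⟨?_, acgkExampleFactor_support, ?_⟩
  · intro h
    have := congrArg (fun p : LaurentPoly 2 => p.coeff ![0, 0]) h
    simp [acgkExampleFactor, coeff_add, coeff_single] at this
  · intro x hx hF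
    have h0 : x 0 ≠ 0 := hx 0
    have hFx : torusEval acgkExampleFactor x = 1 + x 1 := by
      simp [acgkExampleFactor, torusEval_add, Fin.prod_univ_two]
    rw [hFx] at hF ⊢
    simp only [acgkExampleSource, acgkExampleTarget, torusEval_add, torusEval_single,
      Fin.prod_univ_two, Function.update_self,
      Function.update_of_ne (show (1 : Fin 2) ≠ 0 by decide)]
    simp only [Matrix.cons_val_zero, Matrix.cons_val_one, zpow_zero, zpow_one,
      zpow_neg, mul_one, Rat.cast_one, one_mul]
    field_simp
    ring

/-- Hence the two Laurent polynomials of the example are mutation-equivalent. [cite: AkhtarCoatesGalkinKasprzyk2012, §2 Example 1] -/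
theorem acgk_example_isMutationEquivalent :
    IsMutationEquivalent acgkExampleSource acgkExampleTarget :=
  acgk_example_isElementaryMutation.isMutationEquivalent

end Example

end Literature.AlgebraicGeometry.Mutations

end
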